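import Summits.AtomisticToContinuum.FouriersLaw.Theorems.BondHeatUncertaintyLinearResponseFTURFlowFacts
import Summits.AtomisticToContinuum.FouriersLaw.Theorems.BondHeatUncertaintyLinearResponseFTURDiscreteIdentity
import Summits.AtomisticToContinuum.FouriersLaw.Theorems.BondHeatUncertaintyLinearResponseFTUREquilibriumBondHeatVariance

/-!
# The K3 setting: the dyadic schemes of the pinned chain driven by the Brownian pair (K3 helper)

Helper file for stub `stub_antiDampedGirsanov` (K3) of line `lebesgue-flip-duality`, crux ★
`BondHeatUncertainty.LinearResponseFTUR` (stmt-AtomisticToContinuum-9122). Fixes the objects of the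
endgame and records their elementary properties:

* `bathAmp γ T = √(2γT)`; `dyScheme` — the dyadic splitting scheme of the FRICTIONLESS pinned chain
  (`Y₀ = (pinnedChain ω₂ lam β 0).drift N`) with friction `γ`, clamp level `R`, mesh `t/2^m`;
  `incrs t m w` — the grid increments of the Brownian pair (`pairGridIncr`, read through `extIncr`);
  `schemePath … ε σ m y w` — the scheme path of signs `(ε, σ)` driven by them; `bm1`, `bm2` — the two
  Brownian coordinates as real paths;
* `frictionless` — the confined-drift structure of `Y₀`;
* the increments reproduce the increments of the chain noise (`noiseImpulse_incrs`), so that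
  `…SchemeLimit.tendsto_dyadic_path` applies: `tendsto_schemePath_fwd` (damped schemes → `fwdPath`)
  and `tendsto_schemePath_anti` (anti-damped schemes → `thetaRevPath`), each on the event that the two
  bath momenta of the limit path stay in `[-R, R]` on `[0, t]`;
* the bath components of the two integral equations (`snd_bath_of_integralEq`), in the form consumed
  by `…LimitIdentification.tendsto_ito_clamp`;
* measurability in the raw sample of the raw observable of the anti-damped path (the forward one is the
  sibling's `EquilibriumBondHeatVariance.measurable_rawObs_fwdPath`), of the scheme paths and their time integrals.
-/

noncomputable section

namespace Summit.AtomisticToContinuum.FouriersLaw.Theorems.LinearResponseFTUR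

open MeasureTheory Filter Set Function Finset intervalIntegral Topology Metric
open scoped NNReal ENNReal
open Literature.MathematicalPhysics.KineticTheory
open Literature.MathematicalPhysics.KineticTheory.HeatConduction
open Literature.Probability.Process
open Literature.Analysis.ODE
open Summit.AtomisticToContinuum.FouriersLaw.Theorems.BondHeatUncertainty
open Summit.AtomisticToContinuum.FouriersLaw.Theorems.SubdiffusiveBondHeat

variable {N : ℕ}

/-! ### The objects -/

/-- The bath noise amplitude `c = √(2γT)`. -/
def bathAmp (γ T : ℝ) : ℝ := Real.sqrt (2 * γ * T)

/-- `c > 0` for `γ, T > 0`. -/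
theorem bathAmp_pos {γ T : ℝ} (hγ : 0 < γ) (hT : 0 < T) : 0 < bathAmp γ T := by
  unfold bathAmp; positivity

/-- `c² = 2γT` for `γ, T ≥ 0`. -/
theorem bathAmp_sq {γ T : ℝ} (hγ : 0 ≤ γ) (hT : 0 ≤ T) : bathAmp γ T ^ 2 = 2 * γ * T := by
  unfold bathAmp; rw [Real.sq_sqrt (by positivity)]

/-- The dyadic splitting scheme of the frictionless pinned chain (friction `γ`, clamp `R`, mesh `t/2^m`). -/
def dyScheme (ω₂ lam β γ : ℝ) (N : ℕ) (T_L T_R R t : ℝ) (m : ℕ) : SchemeData N :=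
  dyadic ((pinnedChain ω₂ lam β 0).drift N) γ R (bathAmp γ T_L) (bathAmp γ T_R) t m

/-- The grid increments of the Brownian pair over the mesh `t/2^m`, as an infinite sequence. -/
def incrs (t : ℝ) (m : ℕ) (w : WienerPair) : ℕ → ℝ × ℝ :=
  extIncr (2 ^ m) (pairGridIncr (2 ^ m) (t / 2 ^ m) w)

/-- The scheme path of signs `(ε, σ)` and mesh `t/2^m` driven by the Brownian pair of the raw sample `w`. -/
def schemePath (ω₂ lam β γ : ℝ) (N : ℕ) (T_L T_R R t ε σ : ℝ) (m : ℕ) (y : PhaseSpace N)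
    (w : WienerPair) : ℝ → PhaseSpace N :=
  (dyScheme ω₂ lam β γ N T_L T_R R t m).path ε σ (2 ^ m) y (incrs t m w)

/-- The first Brownian coordinate as a real path (clamped on `(-∞, 0]`). -/
def bm1 (w : WienerPair) (s : ℝ) : ℝ := brownian s.toNNReal w.1

/-- The second Brownian coordinate as a real path. -/
def bm2 (w : WienerPair) (s : ℝ) : ℝ := brownian s.toNNReal w.2

/-- `bm1` is continuous. -/
theorem continuous_bm1 (w : WienerPair) : Continuous (bm1 w) :=
  (continuous_brownian w.1).comp continuous_real_toNNReal

/-- `bm2` is continuous. -/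
theorem continuous_bm2 (w : WienerPair) : Continuous (bm2 w) :=
  (continuous_brownian w.2).comp continuous_real_toNNReal

/-- `bm1 w 0 = 0`. -/
@[simp] theorem bm1_zero (w : WienerPair) : bm1 w 0 = 0 := by
  simp [bm1, brownian_zero]

/-- `bm2 w 0 = 0`. -/
@[simp] theorem bm2_zero (w : WienerPair) : bm2 w 0 = 0 := by
  simp [bm2, brownian_zero]

/-- The increments, read inside the range, are the Brownian increments over the cells. -/
theorem incrs_apply {t : ℝ} {m k : ℕ} (hk : k < 2 ^ m) (w : WienerPair) :
    incrs t m w k = (bm1 w (((k : ℝ) + 1) * (t / 2 ^ m)) - bm1 w ((k : ℝ) * (t / 2 ^ m)),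
      bm2 w (((k : ℝ) + 1) * (t / 2 ^ m)) - bm2 w ((k : ℝ) * (t / 2 ^ m))) := by
  simp only [incrs, extIncr_apply_lt _ hk, pairGridIncr, gridIncr, pairPath, bm1, bm2]

/-- Each increment is measurable in the raw sample. -/
theorem measurable_incrs_apply (t : ℝ) (m j : ℕ) : Measurable fun w : WienerPair => incrs t m w j :=
  (measurable_extIncr_apply _ j).comp (measurable_pairGridIncr _ _)

/-- `noiseImpulse` is additive-subtractive in the increments. -/
theorem noiseImpulse_sub (cL cR : ℝ) (a b : ℝ × ℝ) :
    noiseImpulse N cL cR (a - b) = noiseImpulse N cL cR a - noiseImpulse N cL cR b := by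
  simp only [noiseImpulse, Prod.fst_sub, Prod.snd_sub, mul_sub, ← bathVec_sub]
  abel

/-- The chain noise is the `noiseImpulse` of the pair of Brownian values. -/
theorem chainPairNoise_eq (ω₂ lam β γ : ℝ) (N : ℕ) (T_L T_R : ℝ) (w : WienerPair) (s : ℝ) :
    chainPairNoise ω₂ lam β γ N T_L T_R w s =
      noiseImpulse N (bathAmp γ T_L) (bathAmp γ T_R) (bm1 w s, bm2 w s) :=
  chainPairNoise_apply ω₂ lam β γ N T_L T_R w s

/-- **The increments reproduce the increments of the chain noise over the cells.** -/
theorem noiseImpulse_incrs (ω₂ lam β γ : ℝ) (N : ℕ) (T_L T_R t : ℝ) (w : WienerPair) :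
    ∀ m k : ℕ, k < 2 ^ m → noiseImpulse N (bathAmp γ T_L) (bathAmp γ T_R) (incrs t m w k) =
      chainPairNoise ω₂ lam β γ N T_L T_R w (((k : ℝ) + 1) * (t / 2 ^ m)) -
        chainPairNoise ω₂ lam β γ N T_L T_R w ((k : ℝ) * (t / 2 ^ m)) := by
  intro m k hk
  rw [incrs_apply hk, chainPairNoise_eq, chainPairNoise_eq, ← noiseImpulse_sub]
  rfl

/-- The confined-drift structure of the frictionless pinned chain. -/
def frictionless {ω₂ lam β : ℝ} (hω : 0 < ω₂) (hl : 0 ≤ lam) (hβ : 0 ≤ β) (N : ℕ) :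
    ConfinedDrift ((pinnedChain ω₂ lam β 0).drift N) :=
  ((pinnedChain_isConfining hω hl hβ le_rfl).confinedDrift N).toConfinedDrift

/-- Its noise subspace is the momentum subspace. -/
theorem frictionless_noise {ω₂ lam β : ℝ} (hω : 0 < ω₂) (hl : 0 ≤ lam) (hβ : 0 ≤ β) (N : ℕ) :
    (frictionless hω hl hβ N).noise = momentumSubspace N := rfl

/-- The drift of a `dyScheme` is the frictionless drift (definitionally). -/
theorem dyScheme_Y₀ (ω₂ lam β γ : ℝ) (N : ℕ) (T_L T_R R t : ℝ) (m : ℕ) :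
    (dyScheme ω₂ lam β γ N T_L T_R R t m).Y₀ = (pinnedChain ω₂ lam β 0).drift N := rfl

/-! ### Convergence of the schemes to the two paths -/

section Convergence

variable {ω₂ lam β γ : ℝ} (hω : 0 < ω₂) (hl : 0 ≤ lam) (hβ : 0 ≤ β) (hγ : 0 ≤ γ) (N : ℕ) (T_L T_R : ℝ)
  {t : ℝ} (ht : 0 < t) {R : ℝ} (hR : 0 ≤ R) (y : PhaseSpace N) (w : WienerPair)
include hω hl hβ hγ ht hR

/-- **The damped schemes converge to the forward path**, uniformly on `[0, t]`, whenever its two bath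
momenta stay in `[-R, R]`. -/
theorem tendsto_schemePath_fwd
    (hXR : ∀ s ∈ Icc 0 t, |leftMom N (fwdPath (pinnedChain ω₂ lam β γ) N T_L T_R y w s)| ≤ R ∧
      |rightMom N (fwdPath (pinnedChain ω₂ lam β γ) N T_L T_R y w s)| ≤ R) :
    ∀ η : ℝ, 0 < η → ∀ᶠ m : ℕ in atTop, ∀ s ∈ Icc 0 t,
      ‖schemePath ω₂ lam β γ N T_L T_R R t 1 1 m y w s - fwdPath (pinnedChain ω₂ lam β γ) N T_L T_R y w s‖ ≤ η :=
  tendsto_dyadic_path (frictionless hω hl hβ N) rfl ht hR 1 1 (continuous_chainPairNoise ω₂ lam β γ N T_L T_R w)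
    (chainPairNoise_zero ω₂ lam β γ N T_L T_R w) (fun m => incrs t m w)
    (noiseImpulse_incrs ω₂ lam β γ N T_L T_R t w) (continuous_fwdPath hω hl hβ hγ N T_L T_R y w) y
    (fwdPath_integralEq hω hl hβ hγ N T_L T_R y w t) hXR

/-- **The anti-damped schemes converge to the anti-damped path**, uniformly on `[0, t]`, whenever its
two bath momenta stay in `[-R, R]`. -/
theorem tendsto_schemePath_anti
    (hZR : ∀ s ∈ Icc 0 t, |leftMom N (thetaRevPath ω₂ lam β γ N T_L T_R y w s)| ≤ R ∧
      |rightMom N (thetaRevPath ω₂ lam β γ N T_L T_R y w s)| ≤ R) :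
    ∀ η : ℝ, 0 < η → ∀ᶠ m : ℕ in atTop, ∀ s ∈ Icc 0 t,
      ‖schemePath ω₂ lam β γ N T_L T_R R t (-1) (-1) m y w s - thetaRevPath ω₂ lam β γ N T_L T_R y w s‖ ≤ η :=
  tendsto_dyadic_path (frictionless hω hl hβ N) rfl ht hR (-1) (-1)
    (continuous_chainPairNoise ω₂ lam β γ N T_L T_R w) (chainPairNoise_zero ω₂ lam β γ N T_L T_R w)
    (fun m => incrs t m w) (noiseImpulse_incrs ω₂ lam β γ N T_L T_R t w)
    (continuous_thetaRevPath hω hl hβ hγ N T_L T_R y w) y (thetaRevPath_integralEq hω hl hβ hγ N T_L T_R y w t) hZR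

end Convergence

/-! ### The bath components of the integral equations -/

/-- `bathWeight = 1` at the left bath site (`N ≥ 2`). -/
theorem bathWeight_left (hN : 2 ≤ N) (i0 : Fin N) (hi0 : i0.val = 0) : OscillatorChain.bathWeight N i0 = 1 := by
  have h1 : (0 : ℕ) ≠ N - 1 := by omega
  simp [OscillatorChain.bathWeight, hi0, h1]

/-- `bathWeight = 1` at the right bath site (`N ≥ 2`). -/
theorem bathWeight_right (hN : 2 ≤ N) (iN : Fin N) (hiN : iN.val = N - 1) : OscillatorChain.bathWeight N iN = 1 := by
  have h1 : N - 1 ≠ 0 := by omega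
  simp [OscillatorChain.bathWeight, hiN, h1]

/-- The left-bath component of the noise impulse (`N ≥ 2`). -/
theorem noiseImpulse_snd_left (hN : 2 ≤ N) (i0 : Fin N) (hi0 : i0.val = 0) (cL cR : ℝ) (v : ℝ × ℝ) :
    (noiseImpulse N cL cR v).2 i0 = cL * v.1 := by
  have hne : (0 : ℕ) ≠ N - 1 := by omega
  simp [noiseImpulse, bathVec, hi0, hne]

/-- The right-bath component of the noise impulse (`N ≥ 2`). -/
theorem noiseImpulse_snd_right (hN : 2 ≤ N) (iN : Fin N) (hiN : iN.val = N - 1) (cL cR : ℝ) (v : ℝ × ℝ) :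
    (noiseImpulse N cL cR v).2 iN = cR * v.2 := by
  have hne : N - 1 ≠ 0 := by omega
  simp [noiseImpulse, bathVec, hiN, hne]

/-- **The bath component of an integral equation of scheme type.** If a continuous `X` solves
`X(s) = y + (ε n(s) - σγ ∫₀ˢ Π(X)) + ∫₀ˢ Y₀(X)` on `[0, t]` with the chain noise `n`, then at a bath
site `b` (weight `1`, noise component `c_b B^b`)
`p_b(X(s)) = p_b(y) + ε c_b B^b(s) - σγ ∫₀ˢ p_b(X) + ∫₀ˢ Y₀(X)_b`. -/
theorem snd_bath_of_integralEq {Y₀ : PhaseSpace N → PhaseSpace N} (hY₀ : Continuous Y₀) {t ε σ γ cL cR : ℝ}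
    {X : ℝ → PhaseSpace N} (hXc : Continuous X) {y : PhaseSpace N} {B₁ B₂ : ℝ → ℝ}
    (hXeq : ∀ s ∈ Icc 0 t, X s = y + (ε • noiseImpulse N cL cR (B₁ s, B₂ s) -
      (σ * γ) • ∫ u in (0 : ℝ)..s, frictionVec N (X u)) + ∫ u in (0 : ℝ)..s, Y₀ (X u))
    (b : Fin N) (hb : OscillatorChain.bathWeight N b = 1) {c : ℝ} {B : ℝ → ℝ}
    (hnb : ∀ s, (noiseImpulse N cL cR (B₁ s, B₂ s)).2 b = c * B s) :
    ∀ s ∈ Icc 0 t, (X s).2 b = y.2 b + ε * c * B s - σ * γ * (∫ u in (0 : ℝ)..s, (X u).2 b) +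
      ∫ u in (0 : ℝ)..s, (Y₀ (X u)).2 b := by
  intro s hs
  have h := congrArg (fun z : PhaseSpace N => z.2 b) (hXeq s hs)
  simp only [Prod.snd_add, Prod.snd_sub, Pi.add_apply, Pi.sub_apply, Prod.smul_snd, Pi.smul_apply,
    smul_eq_mul, hnb] at h
  have hc1 : Continuous fun u => frictionVec N (X u) := (continuous_frictionVec N).comp hXc
  have hc2 : Continuous fun u => Y₀ (X u) := hY₀.comp hXc
  rw [h, snd_intervalIntegral_apply hc1, snd_intervalIntegral_apply hc2]
  simp only [frictionVec_snd, hb, one_mul]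
  ring

/-! ### Measurability in the raw sample -/

section Measurability

variable {ω₂ lam β γ : ℝ} (hω : 0 < ω₂) (hl : 0 ≤ lam) (hβ : 0 ≤ β) (hγ : 0 ≤ γ) (N : ℕ) (T_L T_R : ℝ)
include hω hl hβ hγ

omit hω hl hβ hγ in
/-- `partialQ i H` of the pinned chain is continuous. -/
theorem continuous_partialQ_pinned (ω₂ lam β γ : ℝ) (i : Fin N) :
    Continuous (partialQ i ((pinnedChain ω₂ lam β γ).hamiltonian N)) := by
  have hU : Differentiable ℝ (pinnedChain ω₂ lam β γ).U :=
    (pinnedChain_contDiff_U ω₂ lam β γ (n := 1)).differentiable one_ne_zero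
  have hV : Differentiable ℝ (pinnedChain ω₂ lam β γ).V :=
    (pinnedChain_contDiff_V ω₂ lam β γ (n := 1)).differentiable one_ne_zero
  have h : partialQ i ((pinnedChain ω₂ lam β γ).hamiltonian N) = fun x => (pinnedChain ω₂ lam β γ).dPotential N i x.1 := by
    funext x; exact OscillatorChain.partialQ_hamiltonian_eq_dPotential _ hU hV N x i
  rw [h]
  exact ((pinnedChain ω₂ lam β γ).contDiff_dPotential (pinnedChain_contDiff_U ω₂ lam β γ)
    (pinnedChain_contDiff_V ω₂ lam β γ) N i).continuous.comp continuous_fst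

omit hω hl hβ hγ in
/-- The bond current of the pinned chain is continuous. -/
theorem continuous_bondCurrent_pinned (ω₂ lam β γ : ℝ) (i : Fin N) :
    Continuous ((pinnedChain ω₂ lam β γ).bondCurrent N i) := by
  unfold OscillatorChain.bondCurrent
  refine continuous_finsetSum _ fun j _ => ?_
  split_ifs
  · have hV : Continuous (deriv (pinnedChain ω₂ lam β γ).V) :=
      ((pinnedChain_contDiff_V ω₂ lam β γ (n := 2)).continuous_deriv (by norm_num))
    fun_prop
  · exact continuous_const

/-- The raw observable of the anti-damped path is measurable in the raw sample. -/
theorem measurable_rawObs_thetaRevPath (i0 iN ib : Fin N) (t : ℝ) (y : PhaseSpace N) :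
    Measurable fun w : WienerPair =>
      rawObs (pinnedChain ω₂ lam β γ) N i0 iN ib t y (thetaRevPath ω₂ lam β γ N T_L T_R y w) := by
  set hP := pinnedChain_isConfining hω hl hβ hγ
  have hm := measurable_pathObs (hP.reversedDrift N).toConfinedDrift
    (v₁ := (pinnedChain ω₂ lam β γ).bathVecL N T_L) (v₂ := (pinnedChain ω₂ lam β γ).bathVecR N T_R)
    (hP.bathVec_mem_reversedDrift_noise N _ _) (hP.bathVec_mem_reversedDrift_noise N _ _)
    ((continuous_apply i0).comp continuous_snd |>.mul (continuous_partialQ_pinned N ω₂ lam β γ i0))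
    ((continuous_apply iN).comp continuous_snd |>.mul (continuous_partialQ_pinned N ω₂ lam β γ iN))
    (continuous_bondCurrent_pinned N ω₂ lam β γ ib) t
  have hpp : Measurable fun w : WienerPair => (((y.1, -y.2) : PhaseSpace N), pairPath w) :=
    measurable_const.prodMk measurable_pairPath
  have hcomp := ((measurable_swapObs N).comp (measurable_flipObs N)).comp (hm.comp hpp)
  convert hcomp using 1
  funext w
  rw [← obs_theta_revPath]
  simp only [Function.comp_apply, Pi.mul_apply, rawObs, workIntegral, bondHeat, BondHeatUncertainty.revPath]

end Measurability

/-! ### Measurability of the scheme functionals in the raw sample -/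

section Measurability

variable {ω₂ lam β : ℝ} (hω : 0 < ω₂) (hl : 0 ≤ lam) (hβ : 0 ≤ β) (γ : ℝ) (N : ℕ) (T_L T_R R t ε σ : ℝ)
  (m : ℕ) (y : PhaseSpace N)
include hω hl hβ

/-- The scheme path is continuous in time. -/
theorem continuous_schemePath (w : WienerPair) : Continuous (schemePath ω₂ lam β γ N T_L T_R R t ε σ m y w) :=
  SchemeData.continuous_path (D := dyScheme ω₂ lam β γ N T_L T_R R t m) (frictionless hω hl hβ N) rfl

/-- The scheme path at a fixed time is measurable in the raw sample. -/
theorem measurable_schemePath (s : ℝ) :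
    Measurable fun w : WienerPair => schemePath ω₂ lam β γ N T_L T_R R t ε σ m y w s :=
  SchemeData.measurable_path (D := dyScheme ω₂ lam β γ N T_L T_R R t m) (frictionless hω hl hβ N) rfl
    (measurable_incrs_apply t m) s

/-- Time integrals of continuous functions along the scheme path are measurable in the raw sample. -/
theorem measurable_schemePathIntegral {f : PhaseSpace N → ℝ} (hf : Continuous f) (t' : ℝ) :
    Measurable fun w : WienerPair => ∫ s in (0 : ℝ)..t', f (schemePath ω₂ lam β γ N T_L T_R R t ε σ m y w s) :=
  SchemeData.measurable_pathIntegral (D := dyScheme ω₂ lam β γ N T_L T_R R t m) (frictionless hω hl hβ N) rfl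
    (measurable_incrs_apply t m) hf t'

/-- The scheme states are measurable in the raw sample. -/
theorem measurable_schemeState (k : ℕ) :
    Measurable fun w : WienerPair => (dyScheme ω₂ lam β γ N T_L T_R R t m).state ε σ y (incrs t m w) k :=
  SchemeData.measurable_state (D := dyScheme ω₂ lam β γ N T_L T_R R t m) (frictionless hω hl hβ N) rfl
    (measurable_incrs_apply t m) k

end Measurability

/-- **The grid increments reproduce the increments of the chain noise** — `∀`-form registered as a sub-goal of the crux item. -/
theorem incrs_noise :
    ∀ (ω₂ lam β γ : ℝ) (N : ℕ) (T_L T_R t : ℝ) (w : WienerPair) (m k : ℕ), k < 2 ^ m → noiseImpulse N (bathAmp γ T_L) (bathAmp γ T_R) (incrs t m w k) = chainPairNoise ω₂ lam β γ N T_L T_R w (((k : ℝ) + 1) * (t / 2 ^ m)) - chainPairNoise ω₂ lam β γ N T_L T_R w ((k : ℝ) * (t / 2 ^ m)) :=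
  fun ω₂ lam β γ N T_L T_R t w m k hk => noiseImpulse_incrs ω₂ lam β γ N T_L T_R t w m k hk

end Summit.AtomisticToContinuum.FouriersLaw.Theorems.LinearResponseFTUR

end
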